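import Literature.NumberTheory.EllipticCurves.TunnellHalfIntegralForms
import Literature.NumberTheory.EllipticCurves.CongruentNumberCurveRootNumberEven
import HarnessLib

/-!
# bsd.S29 (converse of Tunnell's theorem): the whole chain, from Waldspurger's theorem as applied
# on p. 329 down to `tunnell_converse_odd/even`

Bookkeeping file joining the two ends of the Tunnell chain for the named facts
`Literature.NumberTheory.EllipticCurves.tunnell_converse_odd` / `Literature.NumberTheory.EllipticCurves.tunnell_converse_even`
(**bsd.S29**, converse direction; Tunnell 1983, §3; Koblitz, Ch. IV §4), whose imports do not
otherwise meet: the modular-forms side `TunnellHalfIntegralForms` (Tunnell's weight-`3/2` forms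
`g θ_t`, their `q`-expansions, and the p. 329 comparison argument PROVED from
`Tunnell1983_waldspurger_triv/chi2`, Waldspurger's theorem as applied there) and the CM side
`CongruentNumberCurveRootNumber(Even)` (continuation, functional equation and root number of
`L(E_n, s)`, PROVED). It records, as one-line compositions:

* `tunnell_converse_odd_of_waldspurger_triv`, `tunnell_converse_even_of_waldspurger_chi2` —
  **bsd.S29's converse from the single statement `Tunnell1983_waldspurger_triv` (resp. `_chi2`)**;
* `Tunnell1983_a_sq_propto_L_one_of_waldspurger_triv`, `Tunnell1983_b_sq_propto_L_one_of_waldspurger_chi2`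
  — the weaker leaves of `CongruentNumberCurveRootNumber(Even)` (Waldspurger's proportionality on
  two odd classes modulo `8`) follow from it as well;
* `Tunnell1983_L_one_odd_of_waldspurger_triv'`, `Tunnell1983_L_one_even_of_waldspurger_chi2'` —
  Theorem 3 from it and the Birch–Swinnerton-Dyer (1965) `L`-values alone (the continuation
  hypothesis of `Tunnell1983_L_one_odd/even_of_leaves` discharged);
* `Tunnell1983_a_sq_mul_L_one_symm_of_waldspurger_triv` — the constant-free symmetric form
  `a(t)² L(E^{t'}, 1) √t' = a(t')² L(Eᵗ, 1) √t` on the classes `1, 3` modulo `8` (the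
  hypothesis, spelled out, of `tunnell_converse_odd_of_symm` of `CongruentNumberCurveRootNumber`;
  there a theorem from `Tunnell1983_a_sq_propto_L_one`,
  `Tunnell1983_a_sq_mul_L_one_symm_of_propto`) from it, so that this identity too is recorded as
  resting on exactly `Tunnell1983_waldspurger_triv`;
* `tunnell_lvalue_odd_of_mod_eight`, `tunnell_lvalue_even_of_mod_eight` — the vanishing forms
  `tunnell_lvalue_odd/even` of `BSDAnalyticRankProofs` (`L(E_n, 1) = 0 ↔` count identity) hold
  UNCONDITIONALLY for square-free `n ≡ 5, 7 (mod 8)`, resp. `n = 2d`, `d ≡ 3, 7 (mod 8)`: both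
  sides are true (root number `-1`, PROVED in `CongruentNumberCurveRootNumber(Even)`, and both
  ternary counts vanish); so their open content is exactly the classes `1, 3`, resp. `d ≡ 1, 5`
  (mod `8`), i.e. `Tunnell1983_a_sq_propto_L_one` / `Tunnell1983_b_sq_propto_L_one`
  (`tunnell_lvalue_odd_of_propto`, `tunnell_lvalue_even_of_propto`).

State of bsd.S29 (converse) after this file: each half rests on ONE named fact, in either of two
equivalent-strength formulations — `Tunnell1983_waldspurger_triv` (Waldspurger (i)–(ii) + Thm 2 +
the bases of `S_{3/2}(128)`, p. 329) or the strictly weaker `Tunnell1983_a_sq_propto_L_one`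
(the two displays of p. 329), resp. `_chi2` / `Tunnell1983_b_sq_propto_L_one`; forms of
half-integral weight as Hecke eigenforms, the Shimura correspondence and Waldspurger 1981 remain
unformalised.

## References

* J. B. Tunnell, *A classical Diophantine problem and modular forms of weight 3/2*, Invent. Math.
  72 (1983) 323–334: Thm 2 (p. 327), Theorem (Waldspurger) (p. 328), proof of Thm 3 (p. 329), §3
  (p. 330).
* N. Koblitz, *Introduction to Elliptic Curves and Modular Forms*, GTM 97 (1993), Ch. IV §4.
-/

namespace Literature.NumberTheory.EllipticCurves

open Tunnell1983

/-- **`tunnell_converse_odd` (bsd.S29, converse, odd case) from Waldspurger's theorem as applied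
on p. 329** (`Tunnell1983_waldspurger_triv`), everything else proved: the p. 329 comparison
(`Tunnell1983_a_sq_eq_const_mul_L_one_of_facts`), the continuation and root number of `L(E_n, s)`,
and the arithmetic glue (`tunnell_converse_odd_of_waldspurger`).
[cite: Tunnell1983Congruent, Theorem (Waldspurger) p. 328, proof of Thm 3 p. 329, §3 p. 330] -/
theorem tunnell_converse_odd_of_waldspurger_triv (hW : Tunnell1983_waldspurger_triv) :
    tunnell_converse_odd :=
  tunnell_converse_odd_of_waldspurger (Tunnell1983_a_sq_eq_const_mul_L_one_of_facts hW)

/-- **`tunnell_converse_even` (bsd.S29, converse, even case) from Waldspurger's theorem as applied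
on p. 329, character `χ₂`** (`Tunnell1983_waldspurger_chi2`).
[cite: Tunnell1983Congruent, Theorem (Waldspurger) p. 328, proof of Thm 3 p. 329, §3 p. 330] -/
theorem tunnell_converse_even_of_waldspurger_chi2 (hW : Tunnell1983_waldspurger_chi2) :
    tunnell_converse_even :=
  tunnell_converse_even_of_waldspurger (Tunnell1983_b_sq_eq_const_mul_L_one_of_facts hW)

/-- The class-`1, 3` proportionality `Tunnell1983_a_sq_propto_L_one` from Waldspurger's theorem as
applied on p. 329. [cite: Tunnell1983Congruent, proof of Thm 3, p. 329] -/
theorem Tunnell1983_a_sq_propto_L_one_of_waldspurger_triv (hW : Tunnell1983_waldspurger_triv) :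
    Tunnell1983_a_sq_propto_L_one :=
  Tunnell1983_a_sq_propto_L_one_of_const_mul (Tunnell1983_a_sq_eq_const_mul_L_one_of_facts hW)

/-- The class-`1, 5` proportionality `Tunnell1983_b_sq_propto_L_one` from Waldspurger's theorem as
applied on p. 329 (character `χ₂`). [cite: Tunnell1983Congruent, proof of Thm 3, p. 329] -/
theorem Tunnell1983_b_sq_propto_L_one_of_waldspurger_chi2 (hW : Tunnell1983_waldspurger_chi2) :
    Tunnell1983_b_sq_propto_L_one :=
  Tunnell1983_b_sq_propto_L_one_of_const_mul (Tunnell1983_b_sq_eq_const_mul_L_one_of_facts hW)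

/-- **Theorem 3, odd twists, from Waldspurger's theorem as applied on p. 329 and the two
`L`-values `L(E¹, 1) = β/4`, `L(E³, 1) = β/√3`** (`BirchSwinnertonDyer1965_L_one_one_three`); the
continuation input of `Tunnell1983_L_one_odd_of_leaves` is the theorem
`hasEntireLFunction_congruentNumberCurve_holds`. [cite: Tunnell1983Congruent, Thm 3, pp. 328–329] -/
theorem Tunnell1983_L_one_odd_of_waldspurger_triv' (hW : Tunnell1983_waldspurger_triv)
    (hV : BirchSwinnertonDyer1965_L_one_one_three) : Tunnell1983_L_one_odd :=
  Tunnell1983_L_one_odd_of_leaves hW hV hasEntireLFunction_congruentNumberCurve_holds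

/-- **Theorem 3, even twists, from Waldspurger's theorem as applied on p. 329 (character `χ₂`) and
the two `L`-values `L(E², 1)`, `L(E¹⁰, 1)`** (`BirchSwinnertonDyer1965_L_one_two_ten`).
[cite: Tunnell1983Congruent, Thm 3, pp. 328–329] -/
theorem Tunnell1983_L_one_even_of_waldspurger_chi2' (hW : Tunnell1983_waldspurger_chi2)
    (hV : BirchSwinnertonDyer1965_L_one_two_ten) : Tunnell1983_L_one_even :=
  Tunnell1983_L_one_even_of_leaves hW hV hasEntireLFunction_congruentNumberCurve_holds

/-- **The symmetric Waldspurger proportionality on the classes `1, 3` modulo `8` from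
Waldspurger's theorem as applied on p. 329** (`Tunnell1983_waldspurger_triv`): for square-free
`t ≡ t'` both in the class `1` or both in the class `3` modulo `8`,
`a(t)² L(E^{t'}, 1) √t' = a(t')² L(Eᵗ, 1) √t`. Tunnell, p. 329, ll. 7–15: "When `χ` is trivial,
we apply Waldspurger's theorem to find that `∑ A(n^{sf}) c(n) qⁿ`
for the four choices of the function `c(n)` above span the same space as `g θ₂, g θ₈` … Choosing
`c(n)` to be respectively the characteristic functions of `1` and `3` modulo `8` shows that for `n`
square-free `a(n) = β₁ A(n) n^{1/4}` and `a(n) = β₃ A(n) n^{1/4}`. Thus we have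
`a(n)² = β₁² L(Eⁿ, 1) n^{1/2}`, `n ≡ 1 (8)`; `a(n)² = β₃² L(Eⁿ, 1) n^{1/2}`, `n ≡ 3 (8)`" — the
comparison is `Tunnell1983_a_sq_eq_const_mul_L_one_of_facts`, its class-`1, 3` part is
`Tunnell1983_a_sq_propto_L_one_of_waldspurger_triv`, and eliminating the constants `β₁², β₃²` is
`Tunnell1983_a_sq_mul_L_one_symm_of_propto`. So this identity (the hypothesis, spelled out, of
`tunnell_converse_odd_of_symm` in `CongruentNumberCurveRootNumber`) rests on exactly
`Tunnell1983_waldspurger_triv` — Waldspurger 1981, Thm 1, for the Shimura lift of the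
`T(p²)`-eigenforms `g θ₂, g θ₈` (Theorem 2), a theory absent from Mathlib.
[cite: Tunnell1983Congruent, Theorem (Waldspurger) p. 328 and proof of Thm 3, p. 329, ll. 7–15] -/
theorem Tunnell1983_a_sq_mul_L_one_symm_of_waldspurger_triv (hW : Tunnell1983_waldspurger_triv)
    ⦃t t' : ℕ⦄ (ht : Squarefree t) (ht' : Squarefree t') (hcl : t % 8 = 1 ∨ t % 8 = 3)
    (hcl' : t' % 8 = t % 8) (hL : (congruentNumberCurve t).HasEntireLFunction)
    (hL' : (congruentNumberCurve t').HasEntireLFunction) :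
    (a t : ℂ) ^ 2 * (congruentNumberCurve t').entireLFunction 1 * (Real.sqrt t' : ℂ) =
      (a t' : ℂ) ^ 2 * (congruentNumberCurve t).entireLFunction 1 * (Real.sqrt t : ℂ) :=
  Tunnell1983_a_sq_mul_L_one_symm_of_propto (Tunnell1983_a_sq_propto_L_one_of_waldspurger_triv hW)
    ht ht' hcl hcl' hL hL'

/-- **Tunnell's theorem in vanishing form, odd case, holds unconditionally on the classes
`5, 7 (mod 8)`.** For square-free `n ≡ 5, 7 (mod 8)` both sides of the equivalence
`tunnell_lvalue_odd` (`L(E_n, 1) = 0 ↔ #{x²+2y²+8z² = n} = 2·#{x²+2y²+32z² = n}`; Tunnell 1983,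
Thm 3 and §3; Koblitz, Ch. IV §4) hold: `L(E_n, 1) = 0` by the sign `-1` of the functional equation
(`entireLFunction_congruentNumberCurve_one_eq_zero`; Koblitz, Ch. II §5, Theorem, p. 84), and the
count identity because both counts vanish, `x² + 2y² ∈ {0, 1, 2, 3, 4, 6} (mod 8)`
(`Tunnell1983.a_eq_zero_of_mod_eight` with `Tunnell1983.a_eq_zero_iff`; Tunnell p. 329: "`a(n) = 0`
unless `n ≡ 1` or `3` modulo `8`"). So the open content of `tunnell_lvalue_odd` is exactly the
classes `1, 3 (mod 8)`, where it is Waldspurger's proportionality `Tunnell1983_a_sq_propto_L_one`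
(`tunnell_lvalue_odd_of_propto`). No continuation hypothesis is needed
(`hasEntireLFunction_congruentNumberCurve_holds`).
[cite: Tunnell1983Congruent, proof of Thm 3, p. 329] [cite: KoblitzECMF1993, Ch. II §5, Theorem (p. 84)] -/
theorem tunnell_lvalue_odd_of_mod_eight {n : ℕ} (hn : Squarefree n) (h8 : n % 8 = 5 ∨ n % 8 = 7) :
    (congruentNumberCurve n).entireLFunction 1 = 0 ↔
      ternaryFormRepCount 1 2 8 n = 2 * ternaryFormRepCount 1 2 32 n :=
  iff_of_true (entireLFunction_congruentNumberCurve_one_eq_zero hn h8)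
    ((a_eq_zero_iff n).1 (a_eq_zero_of_mod_eight h8))

/-- **Tunnell's theorem in vanishing form, even case, holds unconditionally on the class
`6 (mod 8)`.** For square-free `n ≡ 6 (mod 8)` (`n = 2d`, `d ≡ 3, 7 (mod 8)`) both sides of
`tunnell_lvalue_even` (`L(E_n, 1) = 0 ↔ #{8x²+2y²+16z² = n} = 2·#{8x²+2y²+64z² = n}`) hold:
`L(E_n, 1) = 0` by the root number `χ₋₄(d) = -1`
(`entireLFunction_congruentNumberCurve_one_eq_zero_of_mod_eight_eq_six`; Koblitz, Ch. II §5,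
Theorem, p. 84), and the count identity because `b(d) = 0`, both counts `#{4x²+y²+8z² = d}`,
`#{4x²+y²+32z² = d}` vanishing as `4x² + y² ∈ {0, 1, 4, 5} (mod 8)`
(`Tunnell1983.b_eq_zero_of_mod_eight`, `Tunnell1983.b_eq_zero_iff`; Tunnell p. 329: "`b(n) = 0`
unless `n ≡ 1` or `5` modulo `8`"). So the open content of `tunnell_lvalue_even` is exactly
`d ≡ 1, 5 (mod 8)`, i.e. `Tunnell1983_b_sq_propto_L_one` (`tunnell_lvalue_even_of_propto`).
[cite: Tunnell1983Congruent, proof of Thm 3, p. 329] [cite: KoblitzECMF1993, Ch. II §5, Theorem (p. 84)] -/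
theorem tunnell_lvalue_even_of_mod_eight {n : ℕ} (hn : Squarefree n) (h8 : n % 8 = 6) :
    (congruentNumberCurve n).entireLFunction 1 = 0 ↔
      ternaryFormRepCount 8 2 16 n = 2 * ternaryFormRepCount 8 2 64 n := by
  refine iff_of_true (entireLFunction_congruentNumberCurve_one_eq_zero_of_mod_eight_eq_six hn h8) ?_
  obtain ⟨d, rfl⟩ : ∃ d, n = 2 * d := ⟨n / 2, by omega⟩
  have h := (b_eq_zero_iff d).1 (b_eq_zero_of_mod_eight (by omega))
  push_cast
  exact h

end Literature.NumberTheory.EllipticCurves
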